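import Summits.FinalStateConjecture.FinalStateConjecture.Theorems.PhotonSphereChannelsChannelsResolveTameDevelopmentsRFlatTameEnd
import Literature.Geometry.Lorentzian.SpacetimeKretschmannScalar
import Literature.Geometry.Lorentzian.FlatQuietCollarExclusion
import Literature.Geometry.Lorentzian.CoordRicciPerturbation
import Literature.Geometry.Lorentzian.SpacetimeMetricInCoordsCalculus
import Literature.Geometry.Lorentzian.KerrCurvatureInvariants
import Literature.Geometry.Lorentzian.KerrDataProofs
import Literature.Geometry.Lorentzian.KerrSchildCoord
import Literature.Geometry.Lorentzian.MinkowskiCauchyDevelopment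
import HarnessLib

/-!
# Route PhotonSphereChannels · crux `ChannelsResolveTameDevelopmentsR` (K2R-T2, stmt-FinalStateConjecture-17430) —
# the Kretschmann scalar is CONTINUOUS under pointed `C²` (Cheeger–Gromov) convergence; hull limits of the
# Minkowski MGHD are Kretschmann-flat and carry NO exact Kerr exterior of positive mass

The hull objects of the crux (`TameHull.IsHullElement`; the new line `dark-future-exactness`:
`IsSilentHullElement`, `IsHorizonHullElement`) are pointed `C²_loc` limits
(`Spacetime.LocalSubconvergence`, Petersen 2006 Ch. 10 §3.2) of a development along escaping base points,
and their conclusions sort limits into "Minkowski" or "exact Kerr d.o.c. `(M, a)`, `M > 0`". The one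
curvature quantity the tree reads on abstract spacetimes is the Kretschmann scalar
`Spacetime.kretschmannAt` (`SpacetimeKretschmannScalar.lean`). This file supplies the missing link
between the two:

* §1 `abs_rmNormSqAt_sub_le_of_jets` — pure coordinates: if two metric component fields on `E4` have
  `δ`-close `2`-jets at a point, both bounded by `N` (inverse, first and second derivative), then their
  `|Rm|²` differ by `≤ A(N)·δ` (the perturbation block of `WindowedCollarCurvatureTracking`, made generic:
  Kotschwar's curvature difference identity `IsMetricOn.norm_riemAt_sub_le`, `norm_sharpAt_sub_le`,
  `abs_rmNormSqAt_sub_le`).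
* §2 **`tendsto_kretschmannAt`** — for every convergence datum `D : LocalSubconvergence 𝓢ₙ pₙ 𝓢 p k`,
  `k ≥ 2`, and every point `x` of the limit, `|Rm|²_{𝓢_{sub n}}(φₙ x) → |Rm|²_𝓢(x)`: read both through
  the preferred chart of the limit at `x` (chart independence `rmNormSqAt_metricInCoords_eq_kretschmannAt`;
  the components `φₙ^* g_{sub n}` are eventually nondegenerate at `x` by uniform invertibility near
  `g_𝓢(x)`), and apply §1 with the `C²` sup-norm convergence of the components on a compact coordinate
  ball (`tendsto_supCkENorm`).
* §3 Consequences at the model point: every pointed `C²` limit of the constant Minkowski sequence is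
  KRETSCHMANN-FLAT (`kretschmannAt_eq_zero_of_subconvergesLocallyTo_minkowski`: the terms vanish,
  `Minkowski.kretschmannAt_spacetime`), hence carries NO exact Kerr exterior of positive mass
  (`not_isKerrDoc_of_subconvergesLocallyTo_minkowski`: Kerr transport + `48M²/r⁶ > 0` at an equatorial
  point, `…RFlatTameEnd.exists_equatorial_mem_exterior`); in particular **on the whole hull of the Minkowski MGHD the Kerr branch of
  every hull stub is void** (`not_isKerrDoc_of_isHullElement_minkowski`) — so at the model point the
  horizonless rigidity clause N2 of the line says exactly "every silent outer hull limit of `𝒟_η` is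
  globally Minkowski".

All results proved; the named-fact class `[Kerr.Facts]` is discharged inline. No definitions.

## References

* P. Petersen, *Riemannian Geometry*, 2nd ed. (2006), Ch. 10, §3.2 (pointed `Cᵏ` convergence). [Petersen2006]
* B. Kotschwar, Comm. Anal. Geom. 22 (2014), §1.1 (8) (curvature difference identities). [Kotschwar2014]
* P. Topping, *Lectures on the Ricci flow* (2006), §3.2, (3.2.4) (`|Rm|²`). [Topping2006]
* B. O'Neill, *Semi-Riemannian geometry* (1983), Ch. 3, Prop. 3.41, Prop. 3.59. [ONeill1983]
* M. Visser, arXiv:0706.0622, §3 (Kretschmann scalar of Kerr). [arXiv07060622]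
-/

noncomputable section

set_option maxSynthPendingDepth 3
set_option linter.dupNamespace false

open Set Filter Function TopologicalSpace Metric
open scoped Topology Manifold ContDiff ENNReal NNReal

namespace Summit.FinalStateConjecture.FinalStateConjecture.Theorems.HullCurvature

open Literature.Geometry.Lorentzian
open Literature.Geometry.Lorentzian.MetricCoord
open Literature.Geometry.Lorentzian.KerrWindow (exists_uniform_inverse_bound isOpen_setOf_isInvertible)
open Summit.FinalStateConjecture.FinalStateConjecture.Theorems.TameHull

/-! ## §1 `|Rm|²` is Lipschitz in the `2`-jet (pure coordinates) -/

/-- **`|Rm|²` of two metric component fields with `δ`-close, `N`-bounded `2`-jets differ by `≤ A(N)·δ`.**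
On an open `W ∋ y` let `G, G'` be metric component fields (`IsMetricOn`) with
`‖♯_G(y)‖, ‖♯_{G'}(y)‖, ‖DG(y)‖, ‖DG'(y)‖, ‖D²G(y)‖, ‖D²G'(y)‖ ≤ N` (`N ≥ 1`) and
`‖(G − G')(y)‖, ‖D(G)(y) − D(G')(y)‖, ‖D²G(y) − D²G'(y)‖ ≤ δ ≤ 1`. Then
`| |Rm|²_G(y) − |Rm|²_{G'}(y) | ≤ 4⁴ · 4 · (2N(11N⁴)²N² + 2N²(11N⁴)(42N⁵)) · δ`: curvatures `≤ 11N⁴`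
(`norm_riemAt_apply_le_of_jets`), `‖♯ − ♯'‖ ≤ N²δ` (`norm_sharpAt_sub_le`), `‖R − R'‖ ≤ 42N⁵δ` (Kotschwar,
`IsMetricOn.norm_riemAt_sub_le`), assembled by `abs_rmNormSqAt_sub_le`. [cite: Kotschwar2014, §1.1 (8)] -/
theorem abs_rmNormSqAt_sub_le_of_jets {G G' : E4 → E4 →L[ℝ] E4 →L[ℝ] ℝ} {W : Set E4} {y : E4}
    (hG : IsMetricOn G W) (hG' : IsMetricOn G' W) (hy : y ∈ W) {N δ : ℝ} (hN : 1 ≤ N) (hδ : 0 ≤ δ)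
    (hs : ‖sharpAt G y‖ ≤ N) (hs' : ‖sharpAt G' y‖ ≤ N)
    (h1 : ‖fderiv ℝ G y‖ ≤ N) (h1' : ‖fderiv ℝ G' y‖ ≤ N)
    (h2 : ‖fderiv ℝ (fderiv ℝ G) y‖ ≤ N) (h2' : ‖fderiv ℝ (fderiv ℝ G') y‖ ≤ N)
    (hd0 : ‖G y - G' y‖ ≤ δ) (hd1 : ‖fderiv ℝ G y - fderiv ℝ G' y‖ ≤ δ)
    (hd2 : ‖fderiv ℝ (fderiv ℝ G) y - fderiv ℝ (fderiv ℝ G') y‖ ≤ δ) :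
    |rmNormSqAt G y - rmNormSqAt G' y| ≤
      (4 : ℝ) ^ 4 * (4 * (2 * N * (11 * N ^ 4) ^ 2 * (N ^ 2 * δ)
        + 2 * N ^ 2 * (11 * N ^ 4) * (42 * N ^ 5 * δ))) := by
  have hN0 : 0 ≤ N := zero_le_one.trans hN
  -- curvature bounds `≤ 11 N⁴`
  have hR : ∀ X Y Z : E4, ‖riemAt G y X Y Z‖ ≤ 11 * N ^ 4 * ‖X‖ * ‖Y‖ * ‖Z‖ :=
    hG.norm_riemAt_apply_le_of_jets hy hN hs h1 h2
  have hR' : ∀ X Y Z : E4, ‖riemAt G' y X Y Z‖ ≤ 11 * N ^ 4 * ‖X‖ * ‖Y‖ * ‖Z‖ :=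
    hG'.norm_riemAt_apply_le_of_jets hy hN hs' h1' h2'
  -- `‖♯ − ♯'‖ ≤ N² δ`
  have hsharp : ‖sharpAt G y - sharpAt G' y‖ ≤ N ^ 2 * δ := by
    have h := norm_sharpAt_sub_le (hG.isInvertible y hy) (hG'.isInvertible y hy)
    calc _ ≤ ‖sharpAt G y‖ * ‖G y - G' y‖ * ‖sharpAt G' y‖ := h
      _ ≤ N * δ * N := by gcongr
      _ = N ^ 2 * δ := by ring
  -- `‖R − R'‖ ≤ 42 N⁵ δ`
  have hdR : ∀ X Y Z : E4, ‖riemAt G y X Y Z - riemAt G' y X Y Z‖ ≤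
      42 * N ^ 5 * δ * ‖X‖ * ‖Y‖ * ‖Z‖ := by
    intro X Y Z
    have hmain := hG.norm_riemAt_sub_le hG' hy hN hs hs' h1 h1' h2 X Y Z
    calc ‖riemAt G y X Y Z - riemAt G' y X Y Z‖
        ≤ N ^ 3 * (21 * ‖sharpAt G y - sharpAt G' y‖ + 18 * ‖fderiv ℝ G y - fderiv ℝ G' y‖
            + 3 * ‖fderiv ℝ (fderiv ℝ G) y - fderiv ℝ (fderiv ℝ G') y‖) * ‖X‖ * ‖Y‖ * ‖Z‖ := hmain
      _ ≤ N ^ 3 * (21 * (N ^ 2 * δ) + 18 * (N ^ 2 * δ) + 3 * (N ^ 2 * δ)) * ‖X‖ * ‖Y‖ * ‖Z‖ := by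
          gcongr
          · calc ‖fderiv ℝ G y - fderiv ℝ G' y‖ ≤ δ := hd1
              _ = 1 * δ := (one_mul δ).symm
              _ ≤ N ^ 2 * δ := by gcongr; exact one_le_pow₀ hN
          · calc ‖fderiv ℝ (fderiv ℝ G) y - fderiv ℝ (fderiv ℝ G') y‖ ≤ δ := hd2
              _ = 1 * δ := (one_mul δ).symm
              _ ≤ N ^ 2 * δ := by gcongr; exact one_le_pow₀ hN
      _ = 42 * N ^ 5 * δ * ‖X‖ * ‖Y‖ * ‖Z‖ := by ring
  have key := abs_rmNormSqAt_sub_le (EuclideanSpace.basisFun (Fin 4) ℝ) (G := G) (G' := G')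
    (x := y) (ρ := 11 * N ^ 4) (s := N) (εs := N ^ 2 * δ) (ερ := 42 * N ^ 5 * δ)
    (by positivity) (by positivity) (by positivity) hs hs' hR hR' hsharp hdR
  have hcard : (Fintype.card (Fin 4) : ℝ) = 4 := by norm_num
  have hrank : (Module.finrank ℝ E4 : ℝ) = 4 := by
    rw [finrank_euclideanSpace_fin]; norm_num
  rw [hcard, hrank] at key
  exact key

/-! ## §2 Continuity of the Kretschmann scalar under pointed `C²` convergence -/

/-- Jets of a difference of smooth functions at a point, from its `C²` sup norm on a set containing the
point: `‖(f − g)(y)‖, ‖Df(y) − Dg(y)‖, ‖D²f(y) − D²g(y)‖ ≤ δ` once `sup_{S, m ≤ k} ‖D^m(f − g)‖ ≤ δ`,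
`k ≥ 2`, `y ∈ S`, and `f, g` are `C^∞` near `y`. [folklore] -/
theorem jets_sub_le_of_supCkENorm_le {F : Type*} [NormedAddCommGroup F] [NormedSpace ℝ F]
    {f g : E4 → F} {S : Set E4} {k : ℕ} (hk : 2 ≤ k) {y : E4} (hy : y ∈ S)
    (hf : ContDiffAt ℝ ∞ f y) (hg : ContDiffAt ℝ ∞ g y) {δ : ℝ} (hδ : 0 ≤ δ)
    (h : supCkENorm S k (f - g) ≤ ENNReal.ofReal δ) :
    ‖f y - g y‖ ≤ δ ∧ ‖fderiv ℝ f y - fderiv ℝ g y‖ ≤ δ ∧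
      ‖fderiv ℝ (fderiv ℝ f) y - fderiv ℝ (fderiv ℝ g) y‖ ≤ δ := by
  have hjet : ∀ m ≤ 2, ‖iteratedFDeriv ℝ m (f - g) y‖ ≤ δ := by
    intro m hm
    have h1 := enorm_iteratedFDeriv_le_supCkENorm (hm.trans hk) hy (f - g)
    have h2 : ‖iteratedFDeriv ℝ m (f - g) y‖ₑ ≤ ENNReal.ofReal δ := h1.trans h
    rwa [← ofReal_norm, ENNReal.ofReal_le_ofReal_iff hδ] at h2
  have e0 : ‖(f - g) y‖ ≤ δ := by
    have h := hjet 0 (by norm_num); rwa [norm_iteratedFDeriv_zero] at h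
  have e1 : ‖fderiv ℝ (f - g) y‖ ≤ δ := by
    have h := hjet 1 (by norm_num)
    rwa [← norm_iteratedFDeriv_fderiv (n := 0), norm_iteratedFDeriv_zero] at h
  have e2 : ‖fderiv ℝ (fderiv ℝ (f - g)) y‖ ≤ δ := by
    have h := hjet 2 le_rfl
    rwa [← norm_iteratedFDeriv_fderiv (n := 1), ← norm_iteratedFDeriv_fderiv (n := 0),
      norm_iteratedFDeriv_zero] at h
  -- differentiability near `y` (through the finite order `2`)
  have hf2 : ContDiffAt ℝ 2 f y := hf.of_le (by norm_cast)
  have hg2 : ContDiffAt ℝ 2 g y := hg.of_le (by norm_cast)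
  have hf1 : DifferentiableAt ℝ f y := hf2.differentiableAt (by norm_num)
  have hg1 : DifferentiableAt ℝ g y := hg2.differentiableAt (by norm_num)
  have hfev : ∀ᶠ z in 𝓝 y, DifferentiableAt ℝ f z :=
    (hf2.eventually (by simp)).mono fun z hz ↦ hz.differentiableAt (by norm_num)
  have hgev : ∀ᶠ z in 𝓝 y, DifferentiableAt ℝ g z :=
    (hg2.eventually (by simp)).mono fun z hz ↦ hz.differentiableAt (by norm_num)
  have hsub1 : fderiv ℝ (f - g) =ᶠ[𝓝 y] fun z ↦ fderiv ℝ f z - fderiv ℝ g z := by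
    filter_upwards [hfev, hgev] with z hfz hgz
    exact fderiv_sub hfz hgz
  refine ⟨e0, ?_, ?_⟩
  · have : fderiv ℝ (f - g) y = fderiv ℝ f y - fderiv ℝ g y := fderiv_sub hf1 hg1
    rwa [this] at e1
  · have hdf : DifferentiableAt ℝ (fderiv ℝ f) y :=
      (hf2.fderiv_right (m := 1) (by norm_num)).differentiableAt (by norm_num)
    have hdg : DifferentiableAt ℝ (fderiv ℝ g) y :=
      (hg2.fderiv_right (m := 1) (by norm_num)).differentiableAt (by norm_num)
    have h2 : fderiv ℝ (fderiv ℝ (f - g)) y = fderiv ℝ (fderiv ℝ f) y - fderiv ℝ (fderiv ℝ g) y := by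
      rw [hsub1.fderiv_eq]
      exact fderiv_sub hdf hdg
    rwa [h2] at e2

/-- **The Kretschmann scalar is continuous under pointed `C²` convergence.** For a convergence datum
`D : LocalSubconvergence 𝓢ₙ pₙ 𝓢 p k` with `k ≥ 2` and every point `x` of the limit, the Kretschmann
scalars of the approximants at the comparison images converge:
`|Rm|²_{𝓢_{sub n}}(φₙ x) → |Rm|²_𝓢(x)`. Proof: in the preferred chart `c` of the limit at `x` the
components `Gₙ = (φₙ ∘ c⁻¹)^* g_{sub n}` tend to `G = (c⁻¹)^* g` in `C^k` on a closed coordinate ball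
(`tendsto_supCkENorm`); `G(c x)` is nondegenerate, so for `n` large `Gₙ(c x)` is invertible with
uniformly bounded inverse (`exists_uniform_inverse_bound`), `Gₙ` is a metric component field near
`c x`, `|Rm|²_{Gₙ}(c x) = |Rm|²_{𝓢_{sub n}}(φₙ x)` by chart independence
(`rmNormSqAt_metricInCoords_eq_kretschmannAt`), and §1 bounds `| |Rm|²_{Gₙ} − |Rm|²_G |(c x)` by
`A · δₙ → 0`. [cite: Petersen2006, Ch. 10 §3.2] -/
theorem tendsto_kretschmannAt : ∀ {𝓢ₙ : ℕ → Spacetime.{0} 4} {pₙ : ∀ n, (𝓢ₙ n).carrier} {𝓢 : Spacetime.{0} 4} {p : 𝓢.carrier} {k : ℕ} (D : Spacetime.LocalSubconvergence 𝓢ₙ pₙ 𝓢 p k), 2 ≤ k → ∀ x : 𝓢.carrier, Tendsto (fun n ↦ (𝓢ₙ (D.sub n)).kretschmannAt (D.embed n x)) atTop (𝓝 (𝓢.kretschmannAt x)) := by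
  intro 𝓢ₙ pₙ 𝓢 p k D hk x
  -- the preferred chart of the limit at `x`, its components, the coordinate point
  have hy₀src : x ∈ (chartAt E4 x).source := mem_chart_source E4 x
  have hGm : IsMetricOn (𝓢.metricInCoords (chartAt E4 x).symm) (chartAt E4 x).target :=
    𝓢.isMetricOn_metricInCoords_chartAt_symm x
  have hy₀ : chartAt E4 x x ∈ (chartAt E4 x).target := (chartAt E4 x).map_source hy₀src
  have hK : 𝓢.kretschmannAt x =
      rmNormSqAt (𝓢.metricInCoords (chartAt E4 x).symm) (chartAt E4 x x) := rfl
  -- a closed coordinate ball inside the chart target, and the `C^k` convergence of the components on it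
  obtain ⟨ε, hε, hball⟩ : ∃ ε > 0, closedBall (chartAt E4 x x) ε ⊆ (chartAt E4 x).target :=
    nhds_basis_closedBall.mem_iff.1 ((chartAt E4 x).open_target.mem_nhds hy₀)
  have hconv := D.tendsto_supCkENorm x (closedBall (chartAt E4 x x) ε) (isCompact_closedBall _ ε) hball
  rw [hK]
  generalize hGdef : 𝓢.metricInCoords (chartAt E4 x).symm = G at hGm hconv
  generalize hy₀def : chartAt E4 x x = y₀ at hy₀ hball hconv
  have hy₀K : y₀ ∈ closedBall y₀ ε := mem_closedBall_self hε.le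
  -- `x ∈ U n` eventually
  have hxU : ∀ᶠ n in atTop, x ∈ D.U n := by
    have hx : x ∈ ⋃ n, (D.U n : Set 𝓢.carrier) := by rw [D.iUnion_U]; exact mem_univ x
    obtain ⟨n₀, hn₀⟩ := mem_iUnion.1 hx
    exact eventually_atTop.2 ⟨n₀, fun n hn ↦ D.monotone_U hn hn₀⟩
  -- uniform invertibility near `G y₀`, and one constant `N` for all jets
  have hGy₀ : (G y₀).IsInvertible := hGm.isInvertible y₀ hy₀
  obtain ⟨δ₁, hδ₁, C, hC⟩ := exists_uniform_inverse_bound (K := {G y₀}) isCompact_singleton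
    (by simpa using hGy₀)
  obtain ⟨N, hN1, hCN, hsN, h1N, h2N⟩ : ∃ N : ℝ, 1 ≤ N ∧ C ≤ N ∧ ‖sharpAt G y₀‖ ≤ N ∧
      ‖fderiv ℝ G y₀‖ + 1 ≤ N ∧ ‖fderiv ℝ (fderiv ℝ G) y₀‖ + 1 ≤ N :=
    ⟨max (max (‖sharpAt G y₀‖ + 1) (max C 1)) (max (‖fderiv ℝ G y₀‖ + 1) (‖fderiv ℝ (fderiv ℝ G) y₀‖ + 1)),
      le_trans (le_max_right C 1) ((le_max_right _ _).trans (le_max_left _ _)),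
      (le_max_left C 1).trans ((le_max_right _ _).trans (le_max_left _ _)),
      by linarith [(le_max_left (‖sharpAt G y₀‖ + 1) (max C 1)).trans (le_max_left _
        (max (‖fderiv ℝ G y₀‖ + 1) (‖fderiv ℝ (fderiv ℝ G) y₀‖ + 1)))],
      (le_max_left _ _).trans (le_max_right _ _), (le_max_right _ _).trans (le_max_right _ _)⟩
  have hN0 : 0 ≤ N := zero_le_one.trans hN1
  obtain ⟨A, hA0, hAdef⟩ : ∃ A : ℝ, 0 ≤ A ∧ A = (4 : ℝ) ^ 4 * (4 * (2 * N * (11 * N ^ 4) ^ 2 * N ^ 2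
      + 2 * N ^ 2 * (11 * N ^ 4) * (42 * N ^ 5))) := ⟨_, by positivity, rfl⟩
  -- smoothness of the limit's components at `y₀`
  have hGsm : ContDiffAt ℝ ∞ G y₀ :=
    (hGm.contDiffOn y₀ hy₀).contDiffAt ((chartAt E4 x).open_target.mem_nhds hy₀)
  -- the `ε`–`n₀` argument
  rw [Metric.tendsto_atTop]
  intro η hη
  obtain ⟨δ, hδpos, hδ1, hδδ₁, hδη⟩ : ∃ δ : ℝ, 0 < δ ∧ δ ≤ 1 ∧ δ ≤ δ₁ ∧ A * δ < η := by
    refine ⟨min (min δ₁ 1) (η / (A + 1)), lt_min (lt_min hδ₁ one_pos) (div_pos hη (by positivity)),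
      (min_le_left _ _).trans (min_le_right _ _), (min_le_left _ _).trans (min_le_left _ _), ?_⟩
    have h1 : min (min δ₁ 1) (η / (A + 1)) ≤ η / (A + 1) := min_le_right _ _
    have h2 : A * (η / (A + 1)) < η := by
      rw [mul_div_assoc', div_lt_iff₀ (by positivity)]
      nlinarith
    exact (mul_le_mul_of_nonneg_left h1 hA0).trans_lt h2
  have hsmall : ∀ᶠ n in atTop, supCkENorm (closedBall y₀ ε) k
      ((𝓢ₙ (D.sub n)).metricInCoords (D.embed n ∘ (chartAt E4 x).symm) - G) ≤ ENNReal.ofReal δ :=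
    hconv.eventually (ge_mem_nhds (ENNReal.ofReal_pos.2 hδpos))
  obtain ⟨n₀, hn₀⟩ := eventually_atTop.1 (hsmall.and hxU)
  refine ⟨n₀, fun n hn ↦ ?_⟩
  obtain ⟨hle, hxUn⟩ := hn₀ n hn
  -- the comparison chart map: smooth on `O = c.target ∩ c⁻¹(U n)` ∋ `y₀`
  have hO : IsOpen ((chartAt E4 x).target ∩ (chartAt E4 x).symm ⁻¹' (D.U n : Set 𝓢.carrier)) :=
    (chartAt E4 x).continuousOn_symm.isOpen_inter_preimage (chartAt E4 x).open_target (D.U n).isOpen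
  have hy₀O : y₀ ∈ (chartAt E4 x).target ∩ (chartAt E4 x).symm ⁻¹' (D.U n : Set 𝓢.carrier) := by
    refine ⟨hy₀, ?_⟩
    show (chartAt E4 x).symm y₀ ∈ (D.U n : Set 𝓢.carrier)
    rw [← hy₀def, (chartAt E4 x).left_inv hy₀src]
    exact hxUn
  have hψ : ContMDiffOn 𝓘(ℝ, E4) (𝓡 4) ∞ (D.embed n ∘ (chartAt E4 x).symm)
      ((chartAt E4 x).target ∩ (chartAt E4 x).symm ⁻¹' (D.U n : Set 𝓢.carrier)) :=
    (D.contMDiffOn_embed n).comp ((contMDiffOn_chart_symm (x := x)).mono inter_subset_left)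
      fun z hz ↦ hz.2
  have hGnsm : ContDiffOn ℝ ∞ ((𝓢ₙ (D.sub n)).metricInCoords (D.embed n ∘ (chartAt E4 x).symm))
      ((chartAt E4 x).target ∩ (chartAt E4 x).symm ⁻¹' (D.U n : Set 𝓢.carrier)) :=
    (𝓢ₙ (D.sub n)).contDiffOn_metricInCoords hO hψ
  have hsymm : ∀ (z v w : E4), (𝓢ₙ (D.sub n)).metricInCoords (D.embed n ∘ (chartAt E4 x).symm) z v w =
      (𝓢ₙ (D.sub n)).metricInCoords (D.embed n ∘ (chartAt E4 x).symm) z w v :=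
    fun z v w ↦ (𝓢ₙ (D.sub n)).metricInCoords_symm _ z v w
  -- `|Rm|²` of the comparison components at `y₀` is the approximant's Kretschmann scalar at `φₙ x`
  have hKn : ∀ hinv : ((𝓢ₙ (D.sub n)).metricInCoords (D.embed n ∘ (chartAt E4 x).symm) y₀).IsInvertible,
      rmNormSqAt ((𝓢ₙ (D.sub n)).metricInCoords (D.embed n ∘ (chartAt E4 x).symm)) y₀ =
        (𝓢ₙ (D.sub n)).kretschmannAt (D.embed n x) := by
    intro hinv
    have h := (𝓢ₙ (D.sub n)).rmNormSqAt_metricInCoords_eq_kretschmannAt hO hψ hy₀O hinv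
    have hxx : (D.embed n ∘ (chartAt E4 x).symm) y₀ = D.embed n x := by
      show D.embed n ((chartAt E4 x).symm y₀) = D.embed n x
      rw [← hy₀def, (chartAt E4 x).left_inv hy₀src]
    rw [h, hxx]
  generalize hGndef : (𝓢ₙ (D.sub n)).metricInCoords (D.embed n ∘ (chartAt E4 x).symm) = Gn
    at hle hGnsm hsymm hKn
  generalize hOdef : (chartAt E4 x).target ∩ (chartAt E4 x).symm ⁻¹' (D.U n : Set 𝓢.carrier) = O
    at hO hy₀O hGnsm
  have hOt : O ⊆ (chartAt E4 x).target := by rw [← hOdef]; exact inter_subset_left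
  have hGnat : ContDiffAt ℝ ∞ Gn y₀ := (hGnsm y₀ hy₀O).contDiffAt (hO.mem_nhds hy₀O)
  -- jets `δ`-close at `y₀`
  obtain ⟨hd0, hd1, hd2⟩ := jets_sub_le_of_supCkENorm_le hk hy₀K hGnat hGsm hδpos.le hle
  -- `Gn y₀` invertible with `‖inverse‖ ≤ C`
  have hinv : (Gn y₀).IsInvertible ∧ ‖(Gn y₀).inverse‖ ≤ C :=
    hC (G y₀) (mem_singleton _) (Gn y₀) (hd0.trans hδδ₁)
  -- the open set of smooth nondegenerate chart points around `y₀`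
  have hW : IsOpen (O ∩ Gn ⁻¹' {T | T.IsInvertible}) :=
    hGnsm.continuousOn.isOpen_inter_preimage hO isOpen_setOf_isInvertible
  have hy₀W : y₀ ∈ O ∩ Gn ⁻¹' {T | T.IsInvertible} := ⟨hy₀O, hinv.1⟩
  have hGnm : IsMetricOn Gn (O ∩ Gn ⁻¹' {T | T.IsInvertible}) :=
    { isOpen := hW
      contDiffOn := hGnsm.mono inter_subset_left
      symm := fun z _ v w ↦ hsymm z v w
      isInvertible := fun z hz ↦ hz.2 }
  have hGmW : IsMetricOn G (O ∩ Gn ⁻¹' {T | T.IsInvertible}) :=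
    KerrSchildChart.isMetricOn_mono hGm hW (inter_subset_left.trans hOt)
  -- bounds fed to §1
  have hs' : ‖sharpAt Gn y₀‖ ≤ N := hinv.2.trans hCN
  have h1 : ‖fderiv ℝ G y₀‖ ≤ N := by linarith
  have h2 : ‖fderiv ℝ (fderiv ℝ G) y₀‖ ≤ N := by linarith
  have h1' : ‖fderiv ℝ Gn y₀‖ ≤ N := by
    have := norm_le_norm_add_norm_sub' (fderiv ℝ Gn y₀) (fderiv ℝ G y₀)
    linarith
  have h2' : ‖fderiv ℝ (fderiv ℝ Gn) y₀‖ ≤ N := by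
    have := norm_le_norm_add_norm_sub' (fderiv ℝ (fderiv ℝ Gn) y₀) (fderiv ℝ (fderiv ℝ G) y₀)
    linarith
  have key := abs_rmNormSqAt_sub_le_of_jets hGnm hGmW hy₀W hN1 hδpos.le hs' hsN h1' h1 h2' h2
    hd0 hd1 hd2
  have hup : (4 : ℝ) ^ 4 * (4 * (2 * N * (11 * N ^ 4) ^ 2 * (N ^ 2 * δ)
      + 2 * N ^ 2 * (11 * N ^ 4) * (42 * N ^ 5 * δ))) = A * δ := by rw [hAdef]; ring
  rw [hup, hKn hinv.1] at key
  rw [Real.dist_eq]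
  exact key.trans_lt hδη

/-- The sequence form: if `(𝓢ₙ, pₙ) ⇀ (𝓢, p)` in pointed `Cᵏ`, `k ≥ 2`, then for every point `x` of the
limit there is a subsequence `ρ` and comparison points `xₙ ∈ 𝓢_{ρ n}` with
`|Rm|²_{𝓢_{ρ n}}(xₙ) → |Rm|²_𝓢(x)`. [cite: Petersen2006, Ch. 10 §3.2] -/
theorem exists_tendsto_kretschmannAt_of_subconvergesLocallyTo {𝓢ₙ : ℕ → Spacetime.{0} 4}
    {pₙ : ∀ n, (𝓢ₙ n).carrier} {𝓢 : Spacetime.{0} 4} {p : 𝓢.carrier} {k : ℕ}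
    (h : Spacetime.SubconvergesLocallyTo 𝓢ₙ pₙ 𝓢 p k) (hk : 2 ≤ k) (x : 𝓢.carrier) :
    ∃ (ρ : ℕ → ℕ) (xₙ : ∀ n, (𝓢ₙ (ρ n)).carrier), StrictMono ρ ∧
      Tendsto (fun n ↦ (𝓢ₙ (ρ n)).kretschmannAt (xₙ n)) atTop (𝓝 (𝓢.kretschmannAt x)) := by
  obtain ⟨D⟩ := h
  exact ⟨D.sub, fun n ↦ D.embed n x, D.strictMono_sub, tendsto_kretschmannAt D hk x⟩

/-! ## §3 Hull limits of the Minkowski MGHD are Kretschmann-flat; the Kerr branch is void on its hull -/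

/-- **Pointed `C²` limits of Minkowski spacetime are Kretschmann-flat**: if `(ℝ⁴₁, qₙ) ⇀ (𝓢, p)` in
pointed `Cᵏ`, `k ≥ 2`, then `|Rm|²_𝓢 ≡ 0` (the approximants' scalars vanish identically,
`Minkowski.kretschmannAt_spacetime`). [cite: ONeill1983, Ch. 3, Prop. 3.41] -/
theorem kretschmannAt_eq_zero_of_subconvergesLocallyTo_minkowski {q : ℕ → Minkowski.spacetime.carrier}
    {𝓢 : Spacetime.{0} 4} {p : 𝓢.carrier} {k : ℕ}
    (h : Spacetime.SubconvergesLocallyTo (fun _ : ℕ ↦ Minkowski.spacetime) q 𝓢 p k) (hk : 2 ≤ k)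
    (x : 𝓢.carrier) : 𝓢.kretschmannAt x = 0 := by
  obtain ⟨ρ, xₙ, -, hlim⟩ := exists_tendsto_kretschmannAt_of_subconvergesLocallyTo h hk x
  have h0 : (fun n ↦ (Minkowski.spacetime).kretschmannAt (xₙ n)) = fun _ ↦ (0 : ℝ) :=
    funext fun n ↦ Minkowski.kretschmannAt_spacetime (xₙ n)
  rw [h0] at hlim
  exact tendsto_nhds_unique tendsto_const_nhds hlim |>.symm

/-- **A Kretschmann-flat spacetime carries no exact Kerr exterior of positive mass**: an `IsKerrDoc` chart
is an isometric immersion of the Kerr exterior spacetime, along which the Kretschmann scalars agree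
(`kretschmannAt_comp_of_isIsometricImmersion`), and Kerr's is `48M²/r⁶ > 0` at an equatorial point
(`Kerr.kretschmannScalar_closedForm_holds`). [cite: arXiv07060622, §3] -/
theorem not_isKerrDoc_of_kretschmannAt_eq_zero {𝓢 : Spacetime.{0} 4}
    (h0 : ∀ y : 𝓢.carrier, 𝓢.kretschmannAt y = 0) {O : Set 𝓢.carrier} {M a : ℝ} (hM : 0 < M) :
    ¬ IsKerrDoc 𝓢 O M a := by
  rintro ⟨Ψ, -, hsmooth, -, hdev, -⟩
  haveI : Kerr.Facts :=
    ⟨Kerr.isConnected_region_holds, Kerr.contMDiff_bilin_holds, Kerr.contMDiff_timeVector_holds⟩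
  set 𝓚 : Spacetime.{0} 4 := Kerr.spacetime M a (Kerr.rPlus M a) hM.le with h𝓚
  have hE : 𝓚.metric.IsIsometricImmersion 𝓢.metric.toPseudoRiemannianMetric Ψ := by
    refine ⟨hsmooth, fun y ↦ ?_⟩
    have h := hdev y
    rw [Spacetime.deviation, sub_eq_zero] at h
    exact h
  obtain ⟨x, hx, hx3⟩ := TameHull.FlatEnd.exists_equatorial_mem_exterior M a
  have hcomp := Spacetime.kretschmannAt_comp_of_isIsometricImmersion (𝓢 := 𝓢) (𝓤 := 𝓚) hE ⟨x, hx⟩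
  rw [h0] at hcomp
  have hK : 𝓚.kretschmannAt ⟨x, hx⟩ = MetricCoord.rmNormSqAt (Kerr.bilin M a) x :=
    (Kerr.kretschmannAt_spacetime Kerr.kretschmannScalar_closedForm_holds M a (Kerr.rPlus M a) hM.le
      ⟨x, hx⟩).trans
      (Kerr.kretschmannScalar_closedForm_holds M a x (Kerr.radius_pos_of_mem_region hx)).symm
  have hpos : 0 < MetricCoord.rmNormSqAt (Kerr.bilin M a) x :=
    Kerr.kretschmannScalar_equatorial_pos Kerr.kretschmannScalar_closedForm_holds hM.ne' a
      (Kerr.radius_pos_of_mem_region hx) hx3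
  exact hpos.ne (hcomp.trans hK)

/-- **No pointed `C²` limit of Minkowski spacetime carries an exact Kerr exterior of positive mass.**
[cite: arXiv07060622, §3] -/
theorem not_isKerrDoc_of_subconvergesLocallyTo_minkowski {q : ℕ → Minkowski.spacetime.carrier}
    {𝓢 : Spacetime.{0} 4} {p : 𝓢.carrier} {k : ℕ}
    (h : Spacetime.SubconvergesLocallyTo (fun _ : ℕ ↦ Minkowski.spacetime) q 𝓢 p k) (hk : 2 ≤ k)
    {O : Set 𝓢.carrier} {M a : ℝ} (hM : 0 < M) : ¬ IsKerrDoc 𝓢 O M a :=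
  not_isKerrDoc_of_kretschmannAt_eq_zero (kretschmannAt_eq_zero_of_subconvergesLocallyTo_minkowski h hk) hM

/-- **On the whole hull of the Minkowski MGHD the Kerr branch is void** (registered sub-goal): every hull
element `(q, 𝓢, E, p)` of the Minkowski vacuum Cauchy development (ANY limit spacetime `𝓢`, any class)
is Kretschmann-flat and its spacetime carries no exact Kerr exterior of positive mass — so at the model
point the rigidity dichotomy "Minkowski ∨ Kerr d.o.c." of the hull stubs (N2, T(c) of line
`dark-future-exactness`) says exactly "every silent outer hull limit of `𝒟_η` is globally Minkowski".
[cite: arXiv07060622, §3] -/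
theorem not_isKerrDoc_of_isHullElement_minkowski : ∀ [Minkowski.vacuumCauchyDevelopment.metric.HasLeviCivita] {Λ : ℝ≥0} {r₀ : ℝ} {q : ℕ → Minkowski.vacuumCauchyDevelopment.carrier} {𝓢 : Spacetime.{0} 4} {E : EndDatum 𝓢} {p : 𝓢.carrier}, IsHullElement Minkowski.vacuumCauchyDevelopment Λ r₀ q 𝓢 E p → (∀ x : 𝓢.carrier, 𝓢.kretschmannAt x = 0) ∧ ∀ (O : Set 𝓢.carrier) (M a : ℝ), 0 < M → ¬ IsKerrDoc 𝓢 O M a := by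
  intro _ Λ r₀ q 𝓢 E p hZ
  have hsub : Spacetime.SubconvergesLocallyTo (fun _ : ℕ ↦ Minkowski.spacetime) q 𝓢 p 2 := hZ.subconverges
  exact ⟨kretschmannAt_eq_zero_of_subconvergesLocallyTo_minkowski hsub le_rfl,
    fun O M a hM ↦ not_isKerrDoc_of_subconvergesLocallyTo_minkowski hsub le_rfl hM⟩

end Summit.FinalStateConjecture.FinalStateConjecture.Theorems.HullCurvature

end
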